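import Summits.NavierStokesRegularity.NavierStokesRegularity.Theorems.ScenarioCensusRowA5FsRuns
import HarnessLib

/-!
# Census rows A5fe / A5fi (ns-idea-4 LINE «one-cycle» = the Feller–swirl dictionary) — part 7/7: §5d the LZZ/KNSS class bridge (S4, `CoreAt θ`), §6 the five registered stubs (all PROVED), §7 compositions BY NAME; census keys `row_A5fe_excluded`, `row_A5fi_excluded`

Part 7 of 7 of the port of `OneCycle_v2_3.lean` (sha16 f100b791173babd1); see `ScenarioCensusRowA5FsBox.lean` for the port note.
No census value is asserted here; Row_A5 and NS regularity are NOT proved; no summit statement is proved by this file.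
-/

noncomputable section
set_option linter.dupNamespace false

open MeasureTheory Set Function Filter Topology InnerProductSpace
open scoped Laplacian RealInnerProductSpace ContDiff ENNReal

namespace Summit.NavierStokesRegularity.NavierStokesRegularity.Theorems.ScenarioCensus.FellerSwirl

open Literature.Analysis.FluidPDE
open Summit.NavierStokesRegularity.NavierStokesRegularity.Theorems.ScenarioCensus (Row_A5 Row_A5fe Row_A5fi row_A5fi_of_row_A5fe)

/-! ## §5d (g19, v2.2 — PROVED) S4 — the LZZ/KNSS CLASS BRIDGE `EventualFellerCore → Row_A5fe`
(= feller-swirl O3). Architecture = the tree's `leiZhangZhao2017_liouville_swirl_decay_holds` with the radial-decay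
hypothesis replaced by (bounded swirl + eventual a.e. inflow bound): duality-form class → KNSS bounded weak class up to an
axial drift (`exists_boundedWeak_axisymmetric_modification`, tree) → KNSS §4 representative `U`, `β` with the swirl equation
(5.10) off the axis (`KNSS2009_regularity_axisymmetric_swirl_holds`, tree) → the a.e. hypotheses transfer to the
continuous `Γ_U`, `U` EVERYWHERE (`SereginSverak2009.forall_le_of_ae_le_of_continuousOn`, in `x` on an open set, then in
`t`) → O2 gives `Γ_U ≡ 0` → KNSS Theorem 5.2 as printed (`KNSS2009_liouville_axisymmetric_no_swirl_holds`, tree) →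
every slice a.e. constant (`IsBoundedAncientMildSolution.exists_ae_eq_const_slice`, tree). -/

/-- The conclusion shape shared by O2 (`θ = −(2−δ)`) and O2⁰ (`θ = −2`): the one-sided swirl Liouville core at inflow
threshold `θ` (a definitional convenience for the class bridge, so that ONE proof serves the census rows (δ > 0) and their
exact-threshold sharpening (δ = 0); not an obligation). -/
def CoreAt (θ : ℝ) : Prop :=
  ∀ (f : ℝ → E3 → ℝ) (u : ℝ → E3 → E3) (Cf Cg Cu R₀ : ℝ),
    (∀ t < 0, ContDiff ℝ ∞ (f t)) →
    ContinuousOn (fun p : ℝ × E3 => fderiv ℝ (f p.1) p.2) (Iio 0 ×ˢ univ) →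
    ContinuousOn (fun p : ℝ × E3 => (Δ (f p.1)) p.2) (Iio 0 ×ˢ univ) →
    (∀ t < 0, ∀ x, |f t x| ≤ Cg * cylRadius x) →
    (∀ t < 0, ∀ x, |f t x| ≤ Cf) →
    Measurable (uncurry u) →
    (∀ t < 0, ∀ x, ‖u t x‖ ≤ Cu) →
    (∀ t < 0, ∀ x, R₀ ≤ cylRadius x → θ ≤ x 0 * u t x 0 + x 1 * u t x 1) →
    (∀ x, cylRadius x ≠ 0 → ∀ s t : ℝ, s ≤ t → t < 0 →
      f t x - f s x = ∫ τ in s..t, ((Δ (f τ)) x - fderiv ℝ (f τ) x (u τ x) -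
        2 / cylRadius x * partialDeriv (eR x) (f τ) x)) →
    ∀ t < 0, ∀ x, f t x = 0

/-- PROVED. O2 is the core at threshold `−(2 − δ)`. -/
theorem coreAt_of_eventual (h : EventualFellerCore) {δ : ℝ} (hδ : 0 < δ) : CoreAt (-(2 - δ)) :=
  fun f u Cf Cg Cu R₀ h1 h2 h3 h4 h5 h6 h7 h8 h9 => h f u Cf Cg Cu δ R₀ hδ h1 h2 h3 h4 h5 h6 h7 h8 h9

/-- PROVED. O2⁰ is the core at threshold `−2`. -/
theorem coreAt_of_critical (h : CriticalEventualFellerCore) : CoreAt (-2) :=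
  fun f u Cf Cg Cu R₀ => h f u Cf Cg Cu R₀

/-- (v2.3) **Row A5fe at the EXACT threshold** (the δ = 0 sharpening; NOT a census row): bounded ancient mild, axisymmetric,
bounded swirl, eventual a.e. inflow bound `−r u_r ≤ 2` outside a cylinder ⇒ slices a.e. constant. -/
def CriticalEventualFellerSwirlLiouville : Prop :=
  ∀ u : ℝ → E3 → E3, IsBoundedAncientMildSolution 1 u →
    (∀ t < 0, AEStronglyMeasurable (u t) volume) →
      (∀ t < 0, IsAxisymmetric (u t)) →
        (∃ C : ℝ, ∀ t < 0, ∀ x, |swirl (u t) x| ≤ C) →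
          (∃ R₀ : ℝ, ∀ t < 0, ∀ᵐ x ∂volume, R₀ ≤ cylRadius x → -2 ≤ x 0 * u t x 0 + x 1 * u t x 1) →
            ∀ t < 0, ∃ b : E3, u t =ᵐ[volume] fun _ => b

/-- PROVED (g19). **The core at threshold `θ` in KNSS's class of bounded weak solutions**: a bounded weak solution of
Navier–Stokes (`ν = 1`) on `ℝ³ × (−∞,0)`, axisymmetric as an `L^∞` function, with swirl bounded a.e. and
`θ ≤ x₀u₀ + x₁u₁` a.e. on `{r ≥ R₀}` for a.e. `t`, is swirl-free a.e. — GIVEN `CoreAt θ`. -/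
theorem ae_swirl_free_of_coreAt {θ : ℝ} (hO : CoreAt θ)
    {v : ℝ → E3 → E3} (hv : IsBoundedWeakNSSolutionOn (Iio 0) isOpen_Iio 1 v)
    (hax : ∀ θ' : ℝ, ∀ᵐ t ∂((volume : Measure ℝ).restrict (Iio 0)),
      (fun x => v t (rotZ θ' x)) =ᵐ[volume] fun x => rotZ θ' (v t x))
    {C R₀ : ℝ}
    (hswC : ∀ᵐ t ∂((volume : Measure ℝ).restrict (Iio 0)), ∀ᵐ x ∂(volume : Measure E3),
      |swirl (v t) x| ≤ C)
    (hin : ∀ᵐ t ∂((volume : Measure ℝ).restrict (Iio 0)), ∀ᵐ x ∂(volume : Measure E3),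
      R₀ ≤ cylRadius x → θ ≤ x 0 * v t x 0 + x 1 * v t x 1) :
    ∀ᵐ t ∂((volume : Measure ℝ).restrict (Iio 0)), swirl (v t) =ᵐ[volume] (0 : E3 → ℝ) := by
  obtain ⟨U, β, hβm, ⟨Cβ, hCβ⟩, hUm, hrep, hsmooth, -, -, hbd, hlip, hswirlEq⟩ :=
    KNSS2009_regularity_axisymmetric_swirl_holds hv hax
  set S : Set (ℝ × E3) := Iio 0 ×ˢ univ with hS
  obtain ⟨L₀, hL₀⟩ := hlip 0
  obtain ⟨L₁, hL₁⟩ := hlip 1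
  obtain ⟨L₂, hL₂⟩ := hlip 2
  -- joint continuity of `U` (4.8, `k = 0`), hence continuity in `t` at fixed `x`
  have hUc : ContinuousOn (fun p : ℝ × E3 => U p.1 p.2) S := by
    have h := (ContinuousMultilinearMap.apply ℝ (fun _ : Fin 0 => E3) E3
      (Fin.elim0 : Fin 0 → E3)).continuous.comp_continuousOn (continuousOn_iteratedFDeriv_of_lipschitz hsmooth hL₀)
    refine h.congr fun p _ => ?_
    simp only [comp_apply, ContinuousMultilinearMap.apply_apply, iteratedFDeriv_zero_apply]
  have hUt : ∀ x : E3, ContinuousOn (fun s : ℝ => U s x) (Iio 0) := by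
    intro x
    have hc : Continuous fun s : ℝ => ((s, x) : ℝ × E3) := by fun_prop
    exact hUc.comp hc.continuousOn fun s hs => ⟨hs, mem_univ _⟩
  have hΓt : ∀ x : E3, ContinuousOn (fun s : ℝ => |swirl (U s) x|) (Iio 0) := by
    intro x
    have h2 : ContinuousOn (fun s : ℝ => swirl (U s) x) (Iio 0) := by
      simp only [swirl]
      exact ((continuousOn_const.mul ((PiLp.continuous_apply 2 _ 1).comp_continuousOn (hUt x))).sub
        (continuousOn_const.mul ((PiLp.continuous_apply 2 _ 0).comp_continuousOn (hUt x))))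
    exact h2.abs
  have hΓx : ∀ t < 0, Continuous fun x : E3 => |swirl (U t) x| := fun t ht =>
    (contDiff_swirl (hsmooth t ht)).continuous.abs
  have hIt : ∀ x : E3, ContinuousOn (fun s : ℝ => x 0 * U s x 0 + x 1 * U s x 1) (Iio 0) := fun x =>
    (continuousOn_const.mul ((PiLp.continuous_apply 2 _ 0).comp_continuousOn (hUt x))).add
      (continuousOn_const.mul ((PiLp.continuous_apply 2 _ 1).comp_continuousOn (hUt x)))
  have hIx : ∀ t < 0, Continuous fun x : E3 => x 0 * U t x 0 + x 1 * U t x 1 := fun t ht =>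
    ((PiLp.continuous_apply 2 (fun _ : Fin 3 => ℝ) 0).mul
        ((PiLp.continuous_apply 2 (fun _ : Fin 3 => ℝ) 0).comp (hsmooth t ht).continuous)).add
      ((PiLp.continuous_apply 2 (fun _ : Fin 3 => ℝ) 1).mul
        ((PiLp.continuous_apply 2 (fun _ : Fin 3 => ℝ) 1).comp (hsmooth t ht).continuous))
  -- the bounds `‖U‖ ≤ C₀`, `‖U + βe_z‖ ≤ C₀ + C_β`, `|Γ_U| ≤ (C₀ + C_β) r`
  obtain ⟨C₀, hC₀⟩ := hbd 0
  have hU0 : ∀ t < 0, ∀ x, ‖U t x‖ ≤ C₀ := fun t ht x => by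
    rw [← norm_iteratedFDeriv_zero (𝕜 := ℝ)]; exact hC₀ t ht x
  have heZ : ‖(eZ : E3)‖ = 1 := by simp [eZ]
  have hdrift : ∀ t < 0, ∀ x, ‖U t x + β t • eZ‖ ≤ C₀ + Cβ := fun t ht x =>
    (norm_add_le _ _).trans (add_le_add (hU0 t ht x)
      (by rw [norm_smul, heZ, mul_one, Real.norm_eq_abs]; exact hCβ t))
  have haxis : ∀ t < 0, ∀ x, |swirl (U t) x| ≤ (C₀ + Cβ) * cylRadius x := fun t ht x =>
    (abs_swirl_le_cylRadius_mul_norm_add_smul_eZ (U t) (β t) x).trans (by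
      rw [mul_comm]
      exact mul_le_mul_of_nonneg_right (hdrift t ht x) (cylRadius_nonneg x))
  have hcomp0 : ∀ t x, (U t x + β t • eZ) 0 = U t x 0 := by intro t x; simp [eZ]
  have hcomp1 : ∀ t x, (U t x + β t • eZ) 1 = U t x 1 := by intro t x; simp [eZ]
  -- (a) the swirl bound transfers to `Γ_U` everywhere
  have hCU : ∀ t < 0, ∀ x, |swirl (U t) x| ≤ C := by
    intro t ht x
    have hae : ∀ᵐ s ∂((volume : Measure ℝ).restrict (Iio 0)), |swirl (U s) x| ≤ C := by
      filter_upwards [hrep, hswC, ae_restrict_mem measurableSet_Iio] with s hs hCs hsneg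
      have hae' : ∀ᵐ y ∂(volume : Measure E3), |swirl (U s) y| ≤ C := by
        filter_upwards [hs, hCs] with y hy hCy
        have e : swirl (v s) y = swirl (U s) y := by
          have : swirl (v s) y = swirl (fun y => U s y + β s • eZ) y := by simp only [swirl, hy]
          rw [this, swirl_add_smul_eZ]
        rwa [e] at hCy
      have h := SereginSverak2009.forall_le_of_ae_le_of_continuousOn (μ := (volume : Measure E3))
        isOpen_univ (hΓx s hsneg).continuousOn continuousOn_const
        (by rw [Measure.restrict_univ]; exact hae')
      exact h x (mem_univ _)
    exact SereginSverak2009.forall_le_of_ae_le_of_continuousOn (μ := (volume : Measure ℝ))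
      isOpen_Iio (hΓt x) continuousOn_const hae t ht
  -- (b) the eventual a.e. inflow bound transfers to `U` on `{r ≥ R₀ + 1}`, everywhere
  have hinU : ∀ t < 0, ∀ x, R₀ + 1 ≤ cylRadius x →
      θ ≤ x 0 * (U t x + β t • eZ) 0 + x 1 * (U t x + β t • eZ) 1 := by
    intro t ht x hx
    rw [hcomp0, hcomp1]
    have hxR : R₀ < cylRadius x := by linarith
    have hae : ∀ᵐ s ∂((volume : Measure ℝ).restrict (Iio 0)), θ ≤ x 0 * U s x 0 + x 1 * U s x 1 := by
      filter_upwards [hrep, hin, ae_restrict_mem measurableSet_Iio] with s hs hins hsneg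
      have hae' : ∀ᵐ y ∂(volume : Measure E3), R₀ < cylRadius y →
          θ ≤ y 0 * U s y 0 + y 1 * U s y 1 := by
        filter_upwards [hs, hins] with y hy hiy hyR
        have h := hiy hyR.le
        rw [hy, hcomp0, hcomp1] at h
        exact h
      have hopen : IsOpen {y : E3 | R₀ < cylRadius y} := isOpen_lt continuous_const continuous_cylRadius
      have h := SereginSverak2009.forall_le_of_ae_le_of_continuousOn (μ := (volume : Measure E3))
        hopen continuousOn_const (hIx s hsneg).continuousOn ((ae_restrict_iff' hopen.measurableSet).2 hae')
      exact h x hxR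
    exact SereginSverak2009.forall_le_of_ae_le_of_continuousOn (μ := (volume : Measure ℝ))
      isOpen_Iio continuousOn_const (hIt x) hae t ht
  -- (c) the core: `Γ_U ≡ 0`
  have hzero : ∀ t < 0, ∀ x, swirl (U t) x = 0 :=
    hO (fun t x => swirl (U t) x) (fun t x => U t x + β t • eZ) C (C₀ + Cβ) (C₀ + Cβ) (R₀ + 1)
      (fun t ht => contDiff_swirl (hsmooth t ht))
      (continuousOn_fderiv_swirl_of_lipschitz hsmooth hL₀ hL₁)
      (continuousOn_laplacian_swirl_of_lipschitz hsmooth hL₁ hL₂)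
      haxis hCU
      (show Measurable fun p : ℝ × E3 => U p.1 p.2 + β p.1 • eZ from
        hUm.add ((hβm.comp measurable_fst).smul_const eZ))
      hdrift hinU hswirlEq
  -- (d) back to `v = U + β e_z` a.e.
  filter_upwards [hrep, ae_restrict_mem measurableSet_Iio] with t ht htneg
  filter_upwards [ht] with x hx
  have e : swirl (v t) x = swirl (fun y => U t y + β t • eZ) x := by simp only [swirl, hx]
  rw [e, swirl_add_smul_eZ]
  exact hzero t htneg x

/-- PROVED (g19). **The class bridge at threshold `θ`** (duality-form class): given `CoreAt θ`, a bounded ancient mild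
axisymmetric solution with bounded swirl and `θ ≤ x₀u₀ + x₁u₁` a.e. outside a cylinder has a.e. constant slices. In the
duality-form class, the bounded weak modification `v = u + d(t) e_z` a.e.
(`exists_boundedWeak_axisymmetric_modification`) has the swirl and the inflow number of `u` a.e. (axial constants are
invisible to both), so `ae_swirl_free_of_coreAt` and KNSS's Theorem 5.2 make `v(t) = b(t) e_z`, hence
`u(t) = (b − d)(t) e_z`, a.e. for a.e. `t`, and the solenoidal pairings upgrade this to every `t < 0`. -/
theorem liouville_of_coreAt {θ : ℝ} (hO : CoreAt θ) :
    ∀ u : ℝ → E3 → E3, IsBoundedAncientMildSolution 1 u →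
      (∀ t < 0, AEStronglyMeasurable (u t) volume) →
        (∀ t < 0, IsAxisymmetric (u t)) →
          (∃ C : ℝ, ∀ t < 0, ∀ x, |swirl (u t) x| ≤ C) →
            (∃ R₀ : ℝ, ∀ t < 0, ∀ᵐ x ∂volume, R₀ ≤ cylRadius x → θ ≤ x 0 * u t x 0 + x 1 * u t x 1) →
              ∀ t < 0, ∃ b : E3, u t =ᵐ[volume] fun _ => b := by
  intro u hu hmeas haxi hC hin
  obtain ⟨C, hC⟩ := hC
  obtain ⟨R₀, hin⟩ := hin
  have hν : (0 : ℝ) < 1 := one_pos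
  obtain ⟨v, hweak, hax, hvu⟩ := exists_boundedWeak_axisymmetric_modification hu hmeas haxi
  choose! d hd using hvu
  have hv0 : ∀ t < 0, ∀ᵐ x ∂(volume : Measure E3), v t x = u t x + d t • eZ := fun t ht => hd t ht
  have hswC : ∀ᵐ t ∂((volume : Measure ℝ).restrict (Iio 0)), ∀ᵐ x ∂(volume : Measure E3),
      |swirl (v t) x| ≤ C := by
    filter_upwards [ae_restrict_mem measurableSet_Iio] with t ht
    filter_upwards [hv0 t ht] with x hx
    have e : swirl (v t) x = swirl (fun y => u t y + d t • eZ) x := by simp only [swirl, hx]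
    rw [e, swirl_add_smul_eZ]
    exact hC t ht x
  have hinv : ∀ᵐ t ∂((volume : Measure ℝ).restrict (Iio 0)), ∀ᵐ x ∂(volume : Measure E3),
      R₀ ≤ cylRadius x → θ ≤ x 0 * v t x 0 + x 1 * v t x 1 := by
    filter_upwards [ae_restrict_mem measurableSet_Iio] with t ht
    filter_upwards [hv0 t ht, hin t ht] with x hx hinx hR
    have h0 : v t x 0 = u t x 0 := by rw [hx]; simp [eZ]
    have h1 : v t x 1 = u t x 1 := by rw [hx]; simp [eZ]
    rw [h0, h1]
    exact hinx hR
  have hsw := ae_swirl_free_of_coreAt hO hweak hax hswC hinv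
  obtain ⟨b, -, -, hb⟩ := KNSS2009_liouville_axisymmetric_no_swirl_holds hweak hax hsw
  have hconst : ∀ᵐ t ∂((volume : Measure ℝ).restrict (Iio 0)),
      u t =ᵐ[volume] fun _ => (b t - d t) • eZ := by
    filter_upwards [hb, ae_restrict_mem measurableSet_Iio] with t hbt ht
    filter_upwards [hbt, hv0 t ht] with x hx hx'
    have hx2 : v t x = b t • eZ := hx
    have e : u t x = v t x - d t • eZ := by rw [hx', add_sub_cancel_right]
    rw [e, hx2, sub_smul]
  intro t ht
  exact hu.exists_ae_eq_const_slice hν hmeas hconst t ht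

/-- PROVED (g19, v2.2; v2.3: an instance of `ae_swirl_free_of_coreAt`). O2 in KNSS's bounded weak class. -/
theorem ae_swirl_free_of_eventualFellerCore (hO2 : EventualFellerCore)
    {v : ℝ → E3 → E3} (hv : IsBoundedWeakNSSolutionOn (Iio 0) isOpen_Iio 1 v)
    (hax : ∀ θ : ℝ, ∀ᵐ t ∂((volume : Measure ℝ).restrict (Iio 0)),
      (fun x => v t (rotZ θ x)) =ᵐ[volume] fun x => rotZ θ (v t x))
    {C δ R₀ : ℝ} (hδ : 0 < δ)
    (hswC : ∀ᵐ t ∂((volume : Measure ℝ).restrict (Iio 0)), ∀ᵐ x ∂(volume : Measure E3),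
      |swirl (v t) x| ≤ C)
    (hin : ∀ᵐ t ∂((volume : Measure ℝ).restrict (Iio 0)), ∀ᵐ x ∂(volume : Measure E3),
      R₀ ≤ cylRadius x → -(2 - δ) ≤ x 0 * v t x 0 + x 1 * v t x 1) :
    ∀ᵐ t ∂((volume : Measure ℝ).restrict (Iio 0)), swirl (v t) =ᵐ[volume] (0 : E3 → ℝ) :=
  ae_swirl_free_of_coreAt (coreAt_of_eventual hO2 hδ) hv hax hswC hin

/-- **S4 — PROVED (g19, v2.2).** `EventualFellerCore → Row_A5fe` (feller-swirl O3, the LZZ/KNSS class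
bridge) — the threshold-`−(2−δ)` instance of `liouville_of_coreAt`. -/
theorem eventualFellerSwirlLiouville_of_core : EventualFellerCore → Row_A5fe := by
  intro hO2 u hu hmeas haxi hC hin
  obtain ⟨δ, hδ, R₀, hin⟩ := hin
  exact liouville_of_coreAt (coreAt_of_eventual hO2 hδ) u hu hmeas haxi hC ⟨R₀, hin⟩

/-- PROVED (g19, v2.3). The EXACT-threshold bridge `CriticalEventualFellerCore → CriticalEventualFellerSwirlLiouville`. -/
theorem criticalEventualFellerSwirlLiouville_of_core :
    CriticalEventualFellerCore → CriticalEventualFellerSwirlLiouville :=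
  fun h u hu hmeas haxi hC hin => liouville_of_coreAt (coreAt_of_critical h) u hu hmeas haxi hC hin

/-- PROVED (g19, v2.3). The exact threshold contains the census row's statement (`−(2−δ) ≤ m ⇒ −2 ≤ m`). -/
theorem eventualFellerSwirlLiouville_of_critical (h : CriticalEventualFellerSwirlLiouville) :
    Row_A5fe := by
  intro u hu hmeas haxi hC hin
  obtain ⟨δ, hδ, R₀, hin⟩ := hin
  refine h u hu hmeas haxi hC ⟨R₀, fun t ht => ?_⟩
  filter_upwards [hin t ht] with x hx hR
  have := hx hR
  linarith

/-- PROVED (g19, v2.2). The GLOBAL bridge `FellerCore`-free: row A5fi's Prop from O2 (via A5fe). -/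
theorem fellerSwirlLiouville_of_core (hO2 : EventualFellerCore) : Row_A5fi :=
  row_A5fi_of_row_A5fe (eventualFellerSwirlLiouville_of_core hO2)

/-! ## §6  Registered stubs (v2.3: ALL FIVE — S1, S2, S3, S3⁰, S4 — are PROVED; same decl names and signatures as v1.1; the file has NO `sorry`) -/

/-- **S1 — PROVED (g19, v2)**: the comparison tool (`boxComparison_general`, §S1). -/
theorem stub_boxComparison : BoxComparison :=
  fun _ _ _ _ _ _ _ _ _ _ hg hU hS hD hDU h1 h2 h3 h4 h5 h6 h7 h8 h9 =>
    boxComparison_general hg hU hS hD hDU h1 h2 h3 h4 h5 h6 h7 h8 h9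

-- **S2 — PROVED (g19, v2.1)**: Step A, the core leak, GIVEN the comparison tool = `coreLeak_of_box` (§3c, part 6/7
-- `ScenarioCensusRowA5FsRuns`).  **S3 — PROVED (g19, v2)**: Step B, the far transport = `farTransport_of_box` (§3b, part 6/7).
-- **S3⁰ — PROVED (g19, v2.3)**: the exact-threshold far transport = `criticalFarTransport_of_box` (§3d, part 6/7).
-- (Port note, ARM A g7: v2.3's alias decls `stub_coreLeak := coreLeak_of_box`, `stub_farTransport := farTransport_of_box`,
-- `stub_criticalFarTransport := criticalFarTransport_of_box` are NOT re-declared here — the gate's statement-level dedup lint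
-- refuses aliases of landed theorems; the compositions below cite the part-6 theorems directly.  Same content, same proofs.)

/-- **S4 — PROVED (g19, v2.2)**: the LZZ/KNSS class bridge (`eventualFellerSwirlLiouville_of_core`, §5d). -/
theorem stub_bridge : EventualFellerCore → Row_A5fe :=
  eventualFellerSwirlLiouville_of_core

/-! ## §7  Compositions BY NAME (PROVED modulo the stubs): O2, O1, row A5fe, row A5fi, row A5 from K1, item ⟨2003⟩ -/

/-- O2 from S1–S3. -/
theorem eventualFellerCore_holds : EventualFellerCore :=
  eventualFellerCore_of stub_boxComparison coreLeak_of_box farTransport_of_box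

/-- O1 from O2. -/
theorem fellerCore_holds : FellerCore :=
  fellerCore_of_eventual eventualFellerCore_holds

/-- Census row A5fe (= feller-swirl K2) from S1–S4 — PROVED (v2.2). -/
theorem eventualFellerSwirlLiouville_holds : Row_A5fe :=
  stub_bridge eventualFellerCore_holds

/-- Census row A5fi from row A5fe — PROVED (v2.2). -/
theorem fellerSwirlLiouville_holds : Row_A5fi :=
  row_A5fi_of_row_A5fe eventualFellerSwirlLiouville_holds

/-- (v1.1) O2⁰ (exact threshold) from S1, S2, S3⁰ — PROVED (v2.3). -/
theorem criticalEventualFellerCore_holds : CriticalEventualFellerCore :=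
  criticalEventualFellerCore_of_steps (coreLeak_of_box stub_boxComparison) (criticalFarTransport_of_box stub_boxComparison)

/-- (v2.3) **The exact-threshold sharpening of row A5fe — PROVED**: eventual a.e. inflow bound `−r u_r ≤ 2` (δ = 0) outside a
cylinder ⇒ slices a.e. constant. Not a census row; implies `eventualFellerSwirlLiouville_holds` again via `eventualFellerSwirlLiouville_of_critical`. -/
theorem criticalEventualFellerSwirlLiouville_holds : CriticalEventualFellerSwirlLiouville :=
  criticalEventualFellerSwirlLiouville_of_core criticalEventualFellerCore_holds

/-- (v1.1) O1 from S1 + S3 ONLY (no core leak, `fellerCore_of_farTransport`). -/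
theorem fellerCore_holds' : FellerCore :=
  fellerCore_of_farTransport (farTransport_of_box stub_boxComparison)

/-- The target row A5 BY NAME from the (row-strength, OPEN) crux K1 of feller-swirl ALONE (v2.2: S1–S4 proved): row A5 itself is NOT proved. -/
theorem Row_A5_of (h₁ : FarFieldInflowBound) : Row_A5 :=
  row_A5_of eventualFellerSwirlLiouville_holds h₁

/-- The dormant item ⟨stmt-NavierStokesRegularity-2003⟩ BY NAME from the same. -/
theorem SwirlCriticalLiouville_of (h₁ : FarFieldInflowBound) :
    Summit.NavierStokesRegularity.NavierStokesRegularity.Theses.SwirlThreshold.SwirlCriticalLiouville :=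
  swirlCriticalLiouville_of_row_A5 (Row_A5_of h₁)


end Summit.NavierStokesRegularity.NavierStokesRegularity.Theorems.ScenarioCensus.FellerSwirl

namespace Summit.NavierStokesRegularity.NavierStokesRegularity.Theorems.ScenarioCensus

/-- **Row A5fe — EXCLUDED (the sub-row is PROVED)**: bounded ancient mild axisymmetric `u` (ν = 1, measurable slices) with bounded
swirl and eventual a.e. inflow bound `−r u_r ≤ 2 − δ` on `{r ≥ R₀}` ⇒ slices a.e. constant (`FellerSwirl.eventualFellerSwirlLiouville_holds`:
S1 box comparison + S2 core leak + S3 far transport ⇒ O2 `EventualFellerCore`; S4 the LZZ/KNSS class bridge). Row A5 itself is NOT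
proved (it needs K1 `FellerSwirl.FarFieldInflowBound`). [new] -/
theorem row_A5fe_excluded : Row_A5fe := FellerSwirl.eventualFellerSwirlLiouville_holds

/-- **Row A5fi — EXCLUDED (the sub-row is PROVED)**: the global-inflow-bound sub-case (`FellerSwirl.fellerSwirlLiouville_holds`,
= `row_A5fi_of_row_A5fe row_A5fe_excluded`). [new] -/
theorem row_A5fi_excluded : Row_A5fi := FellerSwirl.fellerSwirlLiouville_holds

/-- Row A5 BY NAME from the one remaining, row-strength, OPEN hypothesis K1 `FellerSwirl.FarFieldInflowBound` (feller-swirl's K1;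
`FellerSwirl.farFieldInflowBound_of_row_A5` is the converse). Row A5 is NOT proved. [new] -/
theorem row_A5_of_farFieldInflowBound (h : FellerSwirl.FarFieldInflowBound) : Row_A5 := FellerSwirl.Row_A5_of h

/-- The δ = 0 sharpening of row A5fe (inflow number `≤ 2` exactly, eventually, a.e.) — PROVED; not a census row. [new] -/
theorem row_A5fe_critical : FellerSwirl.CriticalEventualFellerSwirlLiouville :=
  FellerSwirl.criticalEventualFellerSwirlLiouville_holds

end Summit.NavierStokesRegularity.NavierStokesRegularity.Theorems.ScenarioCensus

end
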